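import Summits.Ventures.WeilGRH.TwistedSechMomentSharp
import Summits.RiemannHypothesis.RiemannHypothesis.Theorems.WeilFormatCSchurStep
import HarnessLib

/-!
# GRH arm (rh-explicit, venture WeilGRH): twisted format C for a COMPLEX ODD character, parity-1 kernel — the data-only
  front door with the ROW-WEIGHTED SHARP `sech` tail

Cell `rh-explicit`, WEIL TRACK — GRH ARM (lit/typing seat weil-grh-5 gen12; weil-grh-2 gen8's near-razor cells 5.2@1,
7.3@1 of the parity-1 complex remainder).  The door `weilPositivityOnChar_of_twistedOddC_formatC_dataJ` of
`TwistedOddComplexDataRungJ.lean` VERBATIM — same table `hM` (`M(κp,κp') = Re twistedGramCoeffOddC χ a p p'`), same far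
weight (`h0`, `hd0`, `hw`), same exact columns, same order-`J` majorant `U₂` of the parity-0 part, same Peter–Paul
parameter `θ'` — except that the scalar of the `sech` tail in `U₂' = (1+θ')U₂ + (1+θ'⁻¹)c·I` is the row-weighted sharp
constant of `TwistedSechMomentSharp.lean`,
`c = c_S^{rw} = R_B·2(a(1 − 1/cosh a)/π²)²/((B₃−B)d₀)`, `R_B = Σ_{k<2B−1}(1/B₃ + [k≠0]/((k+1)/2))²`
(`sechBonus_tail_rw_enum`), in place of the isotropic `c_S = (2B−1)·2(a(1+1/B₃)/π²)²/((B₃−B)d₀)` (`c_S^{rw} = c_S/236` at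
`a = 1`, `(B,B₃) = (48,2048)`).

* `weilPositivityOnChar_of_twistedOddC_formatC_dataJrw` — `q ≠ 1`, `χ` odd mod `q` (complex values included), `a > 0`;
  the symmetric table `M`, block `B ≥ 2`, exact columns `B ≤ |m| < B₃` (`2B ≤ B₃`) with weights `0 < w_j ≤ W((j+1)/2)`,
  order `J`, Hankel weights `lam`, Peter–Paul `θ, η, θ' > 0`, the two sign facts `h0`, `hd0`, and ONE kernel certificate
  `∀ x, 0 ≤ Σ x_i x_{i'} (M(i,i') − Σ_j M(i,j)M(i',j)/w_j − U₂'(i,i'))` ⟹ `WeilPositivityOnChar χ a`.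

Every premise is a finite inequality between explicit reals or ONE PSD check of size `2B − 1`.  No definitions; no named
facts; RH/GRH-free; standard axioms.
-/

set_option autoImplicit false

noncomputable section

open Complex Finset Matrix MeasureTheory Set
open scoped Real BigOperators ComplexConjugate ArithmeticFunction.vonMangoldt

namespace Summit.Ventures.WeilGRH

open Literature.NumberTheory.LFunctions
open Literature.NumberTheory.LFunctions.Yoshida1992 (modes freq mem_modes archExpSumSin)
open Literature.Analysis.SpecialFunctions
open Summit.RiemannHypothesis.RiemannHypothesis.Theorems.WeilFormatC

variable {q : ℕ} {a : ℝ}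

/-! ## The data-only front door for an odd complex character at order `J`, row-weighted sharp `sech` tail -/

section Rung

/-- **Twisted format C for an ODD COMPLEX character with the parity-1 kernel, data-only front door at tail order `J`,
ROW-WEIGHTED `sech` tail.**  Verbatim copy of `weilPositivityOnChar_of_twistedOddC_formatC_dataJ` with the isotropic
constant `c_S = (2B−1)·2(a(1+1/B₃)/π²)²/((B₃−B)d₀)` of `hS` replaced by
`c_S^{rw} = R_B·2(a(1 − 1/cosh a)/π²)²/((B₃−B)d₀)`, `R_B = Σ_{k<2B−1}(1/B₃ + [k≠0]/((k+1)/2))²`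
(`sechBonus_tail_rw_enum`). -/
theorem weilPositivityOnChar_of_twistedOddC_formatC_dataJrw (hq : q ≠ 1) (χ : DirichletCharacter ℂ q)
    (hodd : charParity χ = 1) (ha : 0 < a)
    (M : ℕ → ℕ → ℝ) (hsymm : ∀ j j', M j j' = M j' j)
    (hM : ∀ p p' : ℤ,
      M (if 0 < p then 2 * p.natAbs - 1 else 2 * p.natAbs) (if 0 < p' then 2 * p'.natAbs - 1 else 2 * p'.natAbs)
        = (twistedGramCoeffOddC χ a p p').re)
    {B B₃ : ℕ} (hB : 2 ≤ B) (hBB : 2 * B ≤ B₃) (J : ℕ) (lam : Fin J → ℝ) (hlam : ∀ j, 0 < lam j)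
    {θ η θ' d₀ : ℝ} (hθ : 0 < θ) (hη : 0 < η) (hθ' : 0 < θ') (w : ℕ → ℝ)
    (h0 : 0 < (2 * ((reDigammaQuarter (freq a B) - Real.log π) / 2 - 1 / (8 * (B : ℝ)) - a * (1 + weilArchDensity (2 * a)) / (π ^ 2 * (B : ℝ) ^ 2) - π / 4 - a * (1 + weilArchDensity (2 * a)) / π ^ 2 * Real.sqrt (8 / ((B - 1 : ℕ) : ℝ))) - (∑ k ∈ weilPrimeIndex a, (Λ k : ℝ) / Real.sqrt k * (2 * Real.cos (π / (⌊2 * a / Real.log k⌋₊ + 2)))) + Real.log q))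
    (hd0 : 0 < d₀ ∧ d₀ ≤ (2 * ((reDigammaQuarter (freq a B₃) - Real.log π) / 2 - 1 / (8 * (B₃ : ℝ)) - a * (1 + weilArchDensity (2 * a)) / (π ^ 2 * (B₃ : ℝ) ^ 2) - π / 4 - a * (1 + weilArchDensity (2 * a)) / π ^ 2 * Real.sqrt (8 / ((B - 1 : ℕ) : ℝ))) - (∑ k ∈ weilPrimeIndex a, (Λ k : ℝ) / Real.sqrt k * (2 * Real.cos (π / (⌊2 * a / Real.log k⌋₊ + 2)))) + Real.log q))
    (hw : ∀ j : ℕ, 2 * B - 1 ≤ j → j < 2 * B₃ - 1 → 0 < w j ∧ w j ≤ (2 * ((reDigammaQuarter (freq a ((j + 1) / 2 : ℕ)) - Real.log π) / 2 - 1 / (8 * (((j + 1) / 2 : ℕ) : ℝ)) - a * (1 + weilArchDensity (2 * a)) / (π ^ 2 * (((j + 1) / 2 : ℕ) : ℝ) ^ 2) - (π / 2 - Real.arctan (Real.sqrt ((B - 1 : ℕ) : ℝ) / Real.sqrt (((j + 1) / 2 : ℕ) : ℝ))) / 2 - a * (1 + weilArchDensity (2 * a)) / π ^ 2 * Real.sqrt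 (8 / ((B - 1 : ℕ) : ℝ))) - (∑ k ∈ weilPrimeIndex a, (Λ k : ℝ) / Real.sqrt k * (2 * Real.cos (π / (⌊2 * a / Real.log k⌋₊ + 2)))) + Real.log q))
    (hS : ∀ x : Fin (2 * B - 1) → ℝ, 0 ≤ ∑ i, ∑ i', x i * x i' *
      (M i i' - (∑ j ∈ Finset.Ico (2 * B - 1) (2 * B₃ - 1), M i j * M i' j / w j)
        - (Matrix.of fun i i' : Fin (2 * B - 1) ↦
            ((1 + θ') * (((1 + θ) * (1 + η) * ((π / 4 + (∑ k ∈ weilPrimeIndex a, (Λ k : ℝ) / Real.sqrt k) + a * (1 + weilArchDensity (2 * a)) / (π * B₃)) ^ 2 / (π ^ 2 * d₀)) * (∑ j : Fin J, ∑ j' : Fin J, (((1 / ((((j : ℕ) + 1) + ((j' : ℕ) + 1) - 1 : ℕ) * (((B₃ - 1 : ℕ) : ℝ)) ^ (((j : ℕ) + 1) + ((j' : ℕ) + 1) - 1)) + 1 / ((((j : ℕ) + 1) + ((j' : ℕ) + 1) - 1 : ℕ) * (B₃ : ℝ) ^ (((j : ℕ) + 1) + ((j' : ℕ) + 1) - 1)))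 / 2) + (if j = j' then (∑ j' : Fin J, ((1 / ((((j : ℕ) + 1) + ((j' : ℕ) + 1) - 1 : ℕ) * (((B₃ - 1 : ℕ) : ℝ)) ^ (((j : ℕ) + 1) + ((j' : ℕ) + 1) - 1)) - 1 / ((((j : ℕ) + 1) + ((j' : ℕ) + 1) - 1 : ℕ) * (B₃ : ℝ) ^ (((j : ℕ) + 1) + ((j' : ℕ) + 1) - 1))) / 2) * lam j' / lam j) else 0)) * ((-1 : ℝ) ^ (if (i : ℕ) % 2 = 1 then ((((i : ℕ) + 1) / 2 : ℕ) : ℤ) else -((((i : ℕ) / 2 : ℕ) : ℤ))) * (((if (i : ℕ) % 2 = 1 then ((((i : ℕ) + 1) / 2 : ℕ) : ℤ) else -((((i : ℕ) / 2 : ℕ) : ℤ))) : ℤ) : ℝ) ^ (j : ℕ)) * ((-1 : ℝ) ^ (if (i' : ℕ) % 2 = 1 then ((((i' : ℕ) + 1) / 2 : ℕ) : ℤ) else -((((i' : ℕ) / 2 : ℕ) : ℤ))) * (((if (i' : ℕ) % 2 = 1 then ((((i' : ℕ) + 1) / 2 : ℕ) : ℤ) else -((((i' : ℕ) / 2 :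 ℕ) : ℤ))) : ℤ) : ℝ) ^ (j' : ℕ)))
              + (1 + θ) * (1 + η⁻¹) * (1 / d₀) * (∑ j : Fin J, ∑ j' : Fin J, (((1 / ((((j : ℕ) + 1) + ((j' : ℕ) + 1) - 1 : ℕ) * (((B₃ - 1 : ℕ) : ℝ)) ^ (((j : ℕ) + 1) + ((j' : ℕ) + 1) - 1)) + 1 / ((((j : ℕ) + 1) + ((j' : ℕ) + 1) - 1 : ℕ) * (B₃ : ℝ) ^ (((j : ℕ) + 1) + ((j' : ℕ) + 1) - 1))) / 2) + (if j = j' then (∑ j' : Fin J, ((1 / ((((j : ℕ) + 1) + ((j' : ℕ) + 1) - 1 : ℕ) * (((B₃ - 1 : ℕ) : ℝ)) ^ (((j : ℕ) + 1) + ((j' : ℕ) + 1) - 1)) - 1 / ((((j : ℕ) + 1) + ((j' : ℕ) + 1) - 1 : ℕ) * (B₃ : ℝ) ^ (((j : ℕ) + 1) + ((j' : ℕ) + 1) - 1))) / 2) * lam j' / lam j) else 0)) * ((-1 : ℝ) ^ (if (i : ℕ) % 2 = 1 then ((((i : ℕ) + 1) / 2 : ℕ) : ℤ) else -((((i : ℕ)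 / 2 : ℕ) : ℤ))) * (-((((if (i : ℕ) % 2 = 1 then ((((i : ℕ) + 1) / 2 : ℕ) : ℤ) else -((((i : ℕ) / 2 : ℕ) : ℤ))) : ℤ) : ℝ) ^ (j : ℕ)) * ((Complex.digamma (1 / 4 + ((freq a (if (i : ℕ) % 2 = 1 then ((((i : ℕ) + 1) / 2 : ℕ) : ℤ) else -((((i : ℕ) / 2 : ℕ) : ℤ))) : ℝ) : ℂ) / 2 * I)).im / 2 + (∑ k ∈ weilPrimeIndex a, (Λ k : ℝ) / Real.sqrt k * ((χ (k : ZMod q)).re * Real.sin (freq a (if (i : ℕ) % 2 = 1 then ((((i : ℕ) + 1) / 2 : ℕ) : ℤ) else -((((i : ℕ) / 2 : ℕ) : ℤ))) * Real.log k) + (χ (k : ZMod q)).im * Real.cos (freq a (if (i : ℕ) % 2 = 1 then ((((i : ℕ) + 1) / 2 : ℕ) : ℤ) else -((((i : ℕ) / 2 : ℕ) : ℤ))) * Real.log k))) - archExpSumSin a (if (i : ℕ) % 2 = 1 then ((((i : ℕ) + 1) / 2 : ℕ) : ℤ) else -((((i : ℕ) / 2 : ℕ) : ℤ)))) / π)) *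 ((-1 : ℝ) ^ (if (i' : ℕ) % 2 = 1 then ((((i' : ℕ) + 1) / 2 : ℕ) : ℤ) else -((((i' : ℕ) / 2 : ℕ) : ℤ))) * (-((((if (i' : ℕ) % 2 = 1 then ((((i' : ℕ) + 1) / 2 : ℕ) : ℤ) else -((((i' : ℕ) / 2 : ℕ) : ℤ))) : ℤ) : ℝ) ^ (j' : ℕ)) * ((Complex.digamma (1 / 4 + ((freq a (if (i' : ℕ) % 2 = 1 then ((((i' : ℕ) + 1) / 2 : ℕ) : ℤ) else -((((i' : ℕ) / 2 : ℕ) : ℤ))) : ℝ) : ℂ) / 2 * I)).im / 2 + (∑ k ∈ weilPrimeIndex a, (Λ k : ℝ) / Real.sqrt k * ((χ (k : ZMod q)).re * Real.sin (freq a (if (i' : ℕ) % 2 = 1 then ((((i' : ℕ) + 1) / 2 : ℕ) : ℤ) else -((((i' : ℕ) / 2 : ℕ) : ℤ))) * Real.log k) + (χ (k : ZMod q)).im * Real.cos (freq a (if (i' : ℕ) % 2 = 1 then ((((i' : ℕ) + 1) / 2 : ℕ) : ℤ) else -((((i' : ℕ) / 2 : ℕ) : ℤ))) * Real.log k))) -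 archExpSumSin a (if (i' : ℕ) % 2 = 1 then ((((i' : ℕ) + 1) / 2 : ℕ) : ℤ) else -((((i' : ℕ) / 2 : ℕ) : ℤ)))) / π)))
              + (if i = i' then (1 + θ⁻¹) * (((2 * B - 1 : ℕ) : ℝ) / (d₀ * ((2 * J + 1 : ℕ) * (((B₃ - 1 : ℕ) : ℝ)) ^ (2 * J + 1)))) * (4 * (π / 4 + (∑ k ∈ weilPrimeIndex a, (Λ k : ℝ) / Real.sqrt k) + a * (1 + weilArchDensity (2 * a)) / π) * (((if (i : ℕ) % 2 = 1 then ((((i : ℕ) + 1) / 2 : ℕ) : ℤ) else -((((i : ℕ) / 2 : ℕ) : ℤ)))).natAbs : ℝ) ^ J / π) ^ 2 else 0))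
            + ((1 + θ) * (1 + η) * ((π / 4 + (∑ k ∈ weilPrimeIndex a, (Λ k : ℝ) / Real.sqrt k) + a * (1 + weilArchDensity (2 * a)) / (π * B₃)) ^ 2 / (π ^ 2 * d₀)) * (∑ j : Fin J, ∑ j' : Fin J, (((1 / ((((j : ℕ) + 1) + ((j' : ℕ) + 1) - 1 : ℕ) * (((B₃ - 1 : ℕ) : ℝ)) ^ (((j : ℕ) + 1) + ((j' : ℕ) + 1) - 1)) + 1 / ((((j : ℕ) + 1) + ((j' : ℕ) + 1) - 1 : ℕ) * (B₃ : ℝ) ^ (((j : ℕ) + 1) + ((j' : ℕ) + 1) - 1))) / 2) + (if j = j' then (∑ j' : Fin J, ((1 / ((((j : ℕ) + 1) + ((j' : ℕ) + 1) - 1 : ℕ) * (((B₃ - 1 : ℕ) : ℝ)) ^ (((j : ℕ) + 1) + ((j' : ℕ) + 1) - 1)) - 1 / ((((j : ℕ) + 1) + ((j' : ℕ) + 1) - 1 : ℕ) * (B₃ : ℝ) ^ (((j : ℕ) + 1) + ((j' : ℕ) + 1) - 1))) / 2) * lam j' / lam j) else 0)) * ((-1 : ℝ) ^ ((j : ℕ)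 + 1) * ((-1 : ℝ) ^ (if (i : ℕ) % 2 = 1 then ((((i : ℕ) + 1) / 2 : ℕ) : ℤ) else -((((i : ℕ) / 2 : ℕ) : ℤ))) * (((if (i : ℕ) % 2 = 1 then ((((i : ℕ) + 1) / 2 : ℕ) : ℤ) else -((((i : ℕ) / 2 : ℕ) : ℤ))) : ℤ) : ℝ) ^ (j : ℕ))) * ((-1 : ℝ) ^ ((j' : ℕ) + 1) * ((-1 : ℝ) ^ (if (i' : ℕ) % 2 = 1 then ((((i' : ℕ) + 1) / 2 : ℕ) : ℤ) else -((((i' : ℕ) / 2 : ℕ) : ℤ))) * (((if (i' : ℕ) % 2 = 1 then ((((i' : ℕ) + 1) / 2 : ℕ) : ℤ) else -((((i' : ℕ) / 2 : ℕ) : ℤ))) : ℤ) : ℝ) ^ (j' : ℕ))))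
              + (1 + θ) * (1 + η⁻¹) * (1 / d₀) * (∑ j : Fin J, ∑ j' : Fin J, (((1 / ((((j : ℕ) + 1) + ((j' : ℕ) + 1) - 1 : ℕ) * (((B₃ - 1 : ℕ) : ℝ)) ^ (((j : ℕ) + 1) + ((j' : ℕ) + 1) - 1)) + 1 / ((((j : ℕ) + 1) + ((j' : ℕ) + 1) - 1 : ℕ) * (B₃ : ℝ) ^ (((j : ℕ) + 1) + ((j' : ℕ) + 1) - 1))) / 2) + (if j = j' then (∑ j' : Fin J, ((1 / ((((j : ℕ) + 1) + ((j' : ℕ) + 1) - 1 : ℕ) * (((B₃ - 1 : ℕ) : ℝ)) ^ (((j : ℕ) + 1) + ((j' : ℕ) + 1) - 1)) - 1 / ((((j : ℕ) + 1) + ((j' : ℕ) + 1) - 1 : ℕ) * (B₃ : ℝ) ^ (((j : ℕ) + 1) + ((j' : ℕ) + 1) - 1))) / 2) * lam j' / lam j) else 0)) * ((-1 : ℝ) ^ ((j : ℕ) + 1) * ((-1 : ℝ) ^ (if (i : ℕ) % 2 = 1 then ((((i : ℕ) + 1) / 2 : ℕ) : ℤ) else -((((i : ℕ) / 2 : ℕ)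 : ℤ))) * (-((((if (i : ℕ) % 2 = 1 then ((((i : ℕ) + 1) / 2 : ℕ) : ℤ) else -((((i : ℕ) / 2 : ℕ) : ℤ))) : ℤ) : ℝ) ^ (j : ℕ)) * ((Complex.digamma (1 / 4 + ((freq a (if (i : ℕ) % 2 = 1 then ((((i : ℕ) + 1) / 2 : ℕ) : ℤ) else -((((i : ℕ) / 2 : ℕ) : ℤ))) : ℝ) : ℂ) / 2 * I)).im / 2 + (∑ k ∈ weilPrimeIndex a, (Λ k : ℝ) / Real.sqrt k * ((χ (k : ZMod q)).re * Real.sin (freq a (if (i : ℕ) % 2 = 1 then ((((i : ℕ) + 1) / 2 : ℕ) : ℤ) else -((((i : ℕ) / 2 : ℕ) : ℤ))) * Real.log k) + (χ (k : ZMod q)).im * Real.cos (freq a (if (i : ℕ) % 2 = 1 then ((((i : ℕ) + 1) / 2 : ℕ) : ℤ) else -((((i : ℕ) / 2 : ℕ) : ℤ))) * Real.log k))) - archExpSumSin a (if (i : ℕ) % 2 = 1 then ((((i : ℕ) + 1) / 2 : ℕ) : ℤ) else -((((i : ℕ) / 2 : ℕ) : ℤ)))) / π))) * ((-1 : ℝ)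 ^ ((j' : ℕ) + 1) * ((-1 : ℝ) ^ (if (i' : ℕ) % 2 = 1 then ((((i' : ℕ) + 1) / 2 : ℕ) : ℤ) else -((((i' : ℕ) / 2 : ℕ) : ℤ))) * (-((((if (i' : ℕ) % 2 = 1 then ((((i' : ℕ) + 1) / 2 : ℕ) : ℤ) else -((((i' : ℕ) / 2 : ℕ) : ℤ))) : ℤ) : ℝ) ^ (j' : ℕ)) * ((Complex.digamma (1 / 4 + ((freq a (if (i' : ℕ) % 2 = 1 then ((((i' : ℕ) + 1) / 2 : ℕ) : ℤ) else -((((i' : ℕ) / 2 : ℕ) : ℤ))) : ℝ) : ℂ) / 2 * I)).im / 2 + (∑ k ∈ weilPrimeIndex a, (Λ k : ℝ) / Real.sqrt k * ((χ (k : ZMod q)).re * Real.sin (freq a (if (i' : ℕ) % 2 = 1 then ((((i' : ℕ) + 1) / 2 : ℕ) : ℤ) else -((((i' : ℕ) / 2 : ℕ) : ℤ))) * Real.log k) + (χ (k : ZMod q)).im * Real.cos (freq a (if (i' : ℕ) % 2 = 1 then ((((i' : ℕ) + 1) / 2 : ℕ) : ℤ) else -((((i' : ℕ) / 2 : ℕ)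 : ℤ))) * Real.log k))) - archExpSumSin a (if (i' : ℕ) % 2 = 1 then ((((i' : ℕ) + 1) / 2 : ℕ) : ℤ) else -((((i' : ℕ) / 2 : ℕ) : ℤ)))) / π))))
              + (if i = i' then (1 + θ⁻¹) * (((2 * B - 1 : ℕ) : ℝ) / (d₀ * ((2 * J + 1 : ℕ) * (((B₃ - 1 : ℕ) : ℝ)) ^ (2 * J + 1)))) * (4 * (π / 4 + (∑ k ∈ weilPrimeIndex a, (Λ k : ℝ) / Real.sqrt k) + a * (1 + weilArchDensity (2 * a)) / π) * (((if (i : ℕ) % 2 = 1 then ((((i : ℕ) + 1) / 2 : ℕ) : ℤ) else -((((i : ℕ) / 2 : ℕ) : ℤ)))).natAbs : ℝ) ^ J / π) ^ 2 else 0)))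
            + (if i = i' then (1 + θ'⁻¹) * ((∑ k : Fin (2 * B - 1), (1 / (B₃ : ℝ) + (if (k : ℕ) = 0 then 0 else 1 / ((((k : ℕ) + 1) / 2 : ℕ) : ℝ))) ^ 2) * (2 * (a * (1 - 1 / Real.cosh a) / π ^ 2) ^ 2 / (((B₃ - B : ℕ) : ℝ) * d₀))) else 0))) i i')) :
    WeilPositivityOnChar χ a := by
  have hE0 : 0 < weilArchDensity (2 * a) := weilArchDensity_pos (by positivity)
  have hC : 0 ≤ a * (1 + weilArchDensity (2 * a)) := by positivity
  have hB1 : 1 ≤ B := by omega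
  have hB₃1 : 1 ≤ B₃ := by omega
  -- the far weight as a function of the mode size
  set W : ℕ → ℝ := fun n ↦ (2 * ((reDigammaQuarter (freq a n) - Real.log π) / 2 - 1 / (8 * (n : ℝ)) - a * (1 + weilArchDensity (2 * a)) / (π ^ 2 * (n : ℝ) ^ 2) - (π / 2 - Real.arctan (Real.sqrt ((B - 1 : ℕ) : ℝ) / Real.sqrt (n : ℝ))) / 2 - a * (1 + weilArchDensity (2 * a)) / π ^ 2 * Real.sqrt (8 / ((B - 1 : ℕ) : ℝ))) - (∑ k ∈ weilPrimeIndex a, (Λ k : ℝ) / Real.sqrt k * (2 * Real.cos (π / (⌊2 * a / Real.log k⌋₊ + 2)))) + Real.log q) with hWdef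
  -- the arctan penalty is at most π/4, so `W` dominates the monotone lower profile
  have hWge : ∀ n : ℕ, (2 * ((reDigammaQuarter (freq a n) - Real.log π) / 2 - 1 / (8 * (n : ℝ)) - a * (1 + weilArchDensity (2 * a)) / (π ^ 2 * (n : ℝ) ^ 2) - π / 4 - a * (1 + weilArchDensity (2 * a)) / π ^ 2 * Real.sqrt (8 / ((B - 1 : ℕ) : ℝ))) - (∑ k ∈ weilPrimeIndex a, (Λ k : ℝ) / Real.sqrt k * (2 * Real.cos (π / (⌊2 * a / Real.log k⌋₊ + 2)))) + Real.log q) ≤ W n := by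
    intro n
    have hat : 0 ≤ Real.arctan (Real.sqrt ((B - 1 : ℕ) : ℝ) / Real.sqrt (n : ℝ)) := by
      have h := Real.arctan_strictMono.monotone (by positivity : (0 : ℝ) ≤ Real.sqrt ((B - 1 : ℕ) : ℝ) / Real.sqrt (n : ℝ))
      rwa [Real.arctan_zero] at h
    simp only [hWdef]
    linarith
  have hd : ∀ j : ℕ, 2 * B - 1 ≤ j → 0 < W ((j + 1) / 2) := by
    intro j hj
    have hm : B ≤ (j + 1) / 2 := by omega
    have hmono := even_dhat_core_mono ha hC hB1 hm
    have h := hWge ((j + 1) / 2)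
    push_cast at hmono h h0 ⊢
    linarith
  have hdmono : ∀ m : ℕ, B₃ ≤ m → d₀ ≤ W m := by
    intro m hm
    have hmono := even_dhat_core_mono ha hC hB₃1 hm
    have h := hWge m
    linarith [hd0.2]
  -- the table in mode language
  have hMij : ∀ i j : ℕ, M i j = (twistedGramCoeffOddC χ a
      (if i % 2 = 1 then (((i + 1) / 2 : ℕ) : ℤ) else -((i / 2 : ℕ) : ℤ))
      (if j % 2 = 1 then (((j + 1) / 2 : ℕ) : ℤ) else -((j / 2 : ℕ) : ℤ))).re := by
    intro i j
    rw [← hM, kappa_iota, kappa_iota]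
  have hMsplit : ∀ i j : ℕ, M i j = (twistedGramCoeffC χ a
      (if i % 2 = 1 then (((i + 1) / 2 : ℕ) : ℤ) else -((i / 2 : ℕ) : ℤ))
      (if j % 2 = 1 then (((j + 1) / 2 : ℕ) : ℤ) else -((j / 2 : ℕ) : ℤ))).re
      + ((ite ((if i % 2 = 1 then (((i + 1) / 2 : ℕ) : ℤ) else -((i / 2 : ℕ) : ℤ))
            = (if j % 2 = 1 then (((j + 1) / 2 : ℕ) : ℤ) else -((j / 2 : ℕ) : ℤ))) π 0)
          - sechIncrCoeff a (if i % 2 = 1 then (((i + 1) / 2 : ℕ) : ℤ) else -((i / 2 : ℕ) : ℤ))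
              (if j % 2 = 1 then (((j + 1) / 2 : ℕ) : ℤ) else -((j / 2 : ℕ) : ℤ))) := by
    intro i j
    rw [hMij, re_twistedGramCoeffOddC]
  -- hfar from the mode-level bound, on real vectors
  have hfar : ∀ (N' : ℕ) (y : ℕ → ℝ),
      ∑ j ∈ Finset.Ico (2 * B - 1) N', W ((j + 1) / 2) * y j ^ 2
        ≤ ∑ j ∈ Finset.Ico (2 * B - 1) N', ∑ j' ∈ Finset.Ico (2 * B - 1) N', y j * M j j' * y j' := by
    intro N' y
    set v : ℕ → ℝ := fun j ↦ if 2 * B - 1 ≤ j ∧ j < N' then y j else 0 with hv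
    have hvz : ∀ j, ¬ (2 * B - 1 ≤ j ∧ j < N') → v j = 0 := fun j hj ↦ by simp only [hv, if_neg hj]
    have hsub : Finset.Ico (2 * B - 1) N' ⊆ Finset.range (2 * N' + 1) := fun j hj ↦ by
      rw [Finset.mem_Ico] at hj; rw [Finset.mem_range]; omega
    have hl : ∑ j ∈ Finset.Ico (2 * B - 1) N', W ((j + 1) / 2) * y j ^ 2
        = ∑ j ∈ Finset.range (2 * N' + 1), W ((j + 1) / 2) * v j ^ 2 := by
      rw [← Finset.sum_subset hsub (fun j _ hj ↦ by
        rw [hvz j (by rwa [Finset.mem_Ico] at hj)]; ring)]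
      refine Finset.sum_congr rfl fun j hj ↦ ?_
      rw [Finset.mem_Ico] at hj
      simp only [hv, if_pos hj]
    have hr : ∑ j ∈ Finset.Ico (2 * B - 1) N', ∑ j' ∈ Finset.Ico (2 * B - 1) N', y j * M j j' * y j'
        = ∑ j ∈ Finset.range (2 * N' + 1), ∑ j' ∈ Finset.range (2 * N' + 1), v j * v j' * M j j' := by
      rw [← Finset.sum_subset hsub (fun j _ hj ↦ by
        refine Finset.sum_eq_zero fun j' _ ↦ ?_
        rw [hvz j (by rwa [Finset.mem_Ico] at hj)]; ring)]
      refine Finset.sum_congr rfl fun j hj ↦ ?_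
      rw [← Finset.sum_subset hsub (fun j' _ hj' ↦ by
        rw [hvz j' (by rwa [Finset.mem_Ico] at hj')]; ring)]
      refine Finset.sum_congr rfl fun j' hj' ↦ ?_
      rw [Finset.mem_Ico] at hj hj'
      simp only [hv, if_pos hj, if_pos hj']
      ring
    rw [hl, hr, sum_range_enum (fun j ↦ W ((j + 1) / 2) * v j ^ 2) N',
      sum_sum_range_enum (fun j j' ↦ v j * v j' * M j j') N']
    simp_rw [modeAbs_kappa, hM, re_twistedGramCoeffOddC]
    have hsplit2 : ∑ p ∈ modes N', ∑ p' ∈ modes N',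
        v (if 0 < p then 2 * p.natAbs - 1 else 2 * p.natAbs) * v (if 0 < p' then 2 * p'.natAbs - 1 else 2 * p'.natAbs) * ((twistedGramCoeffC χ a p p').re + ((if p = p' then π else 0) - sechIncrCoeff a p p'))
      = (∑ p ∈ modes N', ∑ p' ∈ modes N', v (if 0 < p then 2 * p.natAbs - 1 else 2 * p.natAbs) * v (if 0 < p' then 2 * p'.natAbs - 1 else 2 * p'.natAbs) * (twistedGramCoeffC χ a p p').re)
        + ∑ p ∈ modes N', ∑ p' ∈ modes N', v (if 0 < p then 2 * p.natAbs - 1 else 2 * p.natAbs) * v (if 0 < p' then 2 * p'.natAbs - 1 else 2 * p'.natAbs) * ((if p = p' then π else 0) - sechIncrCoeff a p p') := by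
      rw [← Finset.sum_add_distrib]
      refine Finset.sum_congr rfl fun p _ ↦ ?_
      rw [← Finset.sum_add_distrib]
      exact Finset.sum_congr rfl fun p' _ ↦ by ring
    rw [hsplit2]
    have hS0 := sechBonus_form_nonneg ha (modes N') (fun p ↦ v (if 0 < p then 2 * p.natAbs - 1 else 2 * p.natAbs))
    refine le_trans ?_ (le_add_of_nonneg_right hS0)
    have key := re_twistedGramCoeffC_modes_far_ge χ ha hB N'
      (fun p ↦ ((v (if 0 < p then 2 * p.natAbs - 1 else 2 * p.natAbs) : ℝ) : ℂ)) (fun p hp ↦ ?_) (fun p hp ↦ ?_)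
    · rw [re_sum_sum_conj_mul_twistedGramCoeffC] at key
      simp only [Complex.ofReal_re, Complex.ofReal_im, mul_zero, add_zero, Complex.norm_real, Real.norm_eq_abs,
        sq_abs] at key
      simpa only [hWdef] using key
    · have h0' := hvz _ (fun h ↦ absurd h.1 (not_le.mpr (kappa_lt_of_natAbs_lt hp)))
      rw [h0']; simp
    · have h0' := hvz _ (fun h ↦ absurd h.2 (not_lt.mpr ((by omega : N' ≤ 2 * N' + 1).trans
        (le_kappa_of_lt_natAbs hp))))
      rw [h0']; simp
  -- exact columns and the order-J tail
  have hU1 : ∀ x : Fin (2 * B - 1) → ℝ,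
      ∑ j ∈ Finset.Ico (2 * B - 1) (2 * B₃ - 1), (∑ i : Fin (2 * B - 1), M i j * x i) ^ 2 / W ((j + 1) / 2)
        ≤ x ⬝ᵥ (Matrix.of fun i i' : Fin (2 * B - 1) ↦
            ∑ j ∈ Finset.Ico (2 * B - 1) (2 * B₃ - 1), M i j * M i' j / w j) *ᵥ x :=
    fun x ↦ columns_majorant (Finset.Ico (2 * B - 1) (2 * B₃ - 1)) (fun j i ↦ M i j) (fun j ↦ W ((j + 1) / 2)) w
      (fun j hj ↦ by
        have hj := Finset.mem_Ico.mp hj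
        have h := hw j hj.1 hj.2
        simp only [hWdef]
        exact h) x
  -- the order-J tail of the parity-0 part and the row-weighted `sech` tail, combined by Peter–Paul
  set UG : Matrix (Fin (2 * B - 1)) (Fin (2 * B - 1)) ℝ := Matrix.of fun i i' : Fin (2 * B - 1) ↦
            ((1 + θ) * (1 + η) * ((π / 4 + (∑ k ∈ weilPrimeIndex a, (Λ k : ℝ) / Real.sqrt k) + a * (1 + weilArchDensity (2 * a)) / (π * B₃)) ^ 2 / (π ^ 2 * d₀)) * (∑ j : Fin J, ∑ j' : Fin J, (((1 / ((((j : ℕ) + 1) + ((j' : ℕ) + 1) - 1 : ℕ) * (((B₃ - 1 : ℕ) : ℝ)) ^ (((j : ℕ) + 1) + ((j' : ℕ) + 1) - 1)) + 1 / ((((j : ℕ) + 1) + ((j' : ℕ) + 1) - 1 : ℕ) * (B₃ : ℝ) ^ (((j : ℕ) + 1) + ((j' : ℕ) + 1) - 1))) / 2) + (if j = j' then (∑ j' : Fin J, ((1 / ((((j : ℕ) + 1) + ((j' : ℕ) + 1) - 1 : ℕ) * (((B₃ - 1 : ℕ) : ℝ)) ^ (((j : ℕ) + 1) + ((j' : ℕ)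 + 1) - 1)) - 1 / ((((j : ℕ) + 1) + ((j' : ℕ) + 1) - 1 : ℕ) * (B₃ : ℝ) ^ (((j : ℕ) + 1) + ((j' : ℕ) + 1) - 1))) / 2) * lam j' / lam j) else 0)) * ((-1 : ℝ) ^ (if (i : ℕ) % 2 = 1 then ((((i : ℕ) + 1) / 2 : ℕ) : ℤ) else -((((i : ℕ) / 2 : ℕ) : ℤ))) * (((if (i : ℕ) % 2 = 1 then ((((i : ℕ) + 1) / 2 : ℕ) : ℤ) else -((((i : ℕ) / 2 : ℕ) : ℤ))) : ℤ) : ℝ) ^ (j : ℕ)) * ((-1 : ℝ) ^ (if (i' : ℕ) % 2 = 1 then ((((i' : ℕ) + 1) / 2 : ℕ) : ℤ) else -((((i' : ℕ) / 2 : ℕ) : ℤ))) * (((if (i' : ℕ) % 2 = 1 then ((((i' : ℕ) + 1) / 2 : ℕ) : ℤ) else -((((i' : ℕ) / 2 : ℕ) : ℤ))) : ℤ) : ℝ) ^ (j' : ℕ)))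
              + (1 + θ) * (1 + η⁻¹) * (1 / d₀) * (∑ j : Fin J, ∑ j' : Fin J, (((1 / ((((j : ℕ) + 1) + ((j' : ℕ) + 1) - 1 : ℕ) * (((B₃ - 1 : ℕ) : ℝ)) ^ (((j : ℕ) + 1) + ((j' : ℕ) + 1) - 1)) + 1 / ((((j : ℕ) + 1) + ((j' : ℕ) + 1) - 1 : ℕ) * (B₃ : ℝ) ^ (((j : ℕ) + 1) + ((j' : ℕ) + 1) - 1))) / 2) + (if j = j' then (∑ j' : Fin J, ((1 / ((((j : ℕ) + 1) + ((j' : ℕ) + 1) - 1 : ℕ) * (((B₃ - 1 : ℕ) : ℝ)) ^ (((j : ℕ) + 1) + ((j' : ℕ) + 1) - 1)) - 1 / ((((j : ℕ) + 1) + ((j' : ℕ) + 1) - 1 : ℕ) * (B₃ : ℝ) ^ (((j : ℕ) + 1) + ((j' : ℕ) + 1) - 1))) / 2) * lam j' / lam j) else 0)) * ((-1 : ℝ) ^ (if (i : ℕ) % 2 = 1 then ((((i : ℕ) + 1) / 2 : ℕ) : ℤ) else -((((i : ℕ) / 2 : ℕ) : ℤ))) * (-((((if (i : ℕ) % 2 =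 1 then ((((i : ℕ) + 1) / 2 : ℕ) : ℤ) else -((((i : ℕ) / 2 : ℕ) : ℤ))) : ℤ) : ℝ) ^ (j : ℕ)) * ((Complex.digamma (1 / 4 + ((freq a (if (i : ℕ) % 2 = 1 then ((((i : ℕ) + 1) / 2 : ℕ) : ℤ) else -((((i : ℕ) / 2 : ℕ) : ℤ))) : ℝ) : ℂ) / 2 * I)).im / 2 + (∑ k ∈ weilPrimeIndex a, (Λ k : ℝ) / Real.sqrt k * ((χ (k : ZMod q)).re * Real.sin (freq a (if (i : ℕ) % 2 = 1 then ((((i : ℕ) + 1) / 2 : ℕ) : ℤ) else -((((i : ℕ) / 2 : ℕ) : ℤ))) * Real.log k) + (χ (k : ZMod q)).im * Real.cos (freq a (if (i : ℕ) % 2 = 1 then ((((i : ℕ) + 1) / 2 : ℕ) : ℤ) else -((((i : ℕ) / 2 : ℕ) : ℤ))) * Real.log k))) - archExpSumSin a (if (i : ℕ) % 2 = 1 then ((((i : ℕ) + 1) / 2 : ℕ) : ℤ) else -((((i : ℕ) / 2 : ℕ) : ℤ)))) / π)) * ((-1 : ℝ) ^ (if (i' : ℕ) % 2 = 1 then ((((i'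 : ℕ) + 1) / 2 : ℕ) : ℤ) else -((((i' : ℕ) / 2 : ℕ) : ℤ))) * (-((((if (i' : ℕ) % 2 = 1 then ((((i' : ℕ) + 1) / 2 : ℕ) : ℤ) else -((((i' : ℕ) / 2 : ℕ) : ℤ))) : ℤ) : ℝ) ^ (j' : ℕ)) * ((Complex.digamma (1 / 4 + ((freq a (if (i' : ℕ) % 2 = 1 then ((((i' : ℕ) + 1) / 2 : ℕ) : ℤ) else -((((i' : ℕ) / 2 : ℕ) : ℤ))) : ℝ) : ℂ) / 2 * I)).im / 2 + (∑ k ∈ weilPrimeIndex a, (Λ k : ℝ) / Real.sqrt k * ((χ (k : ZMod q)).re * Real.sin (freq a (if (i' : ℕ) % 2 = 1 then ((((i' : ℕ) + 1) / 2 : ℕ) : ℤ) else -((((i' : ℕ) / 2 : ℕ) : ℤ))) * Real.log k) + (χ (k : ZMod q)).im * Real.cos (freq a (if (i' : ℕ) % 2 = 1 then ((((i' : ℕ) + 1) / 2 : ℕ) : ℤ) else -((((i' : ℕ) / 2 : ℕ) : ℤ))) * Real.log k))) - archExpSumSin a (if (i' : ℕ) % 2 = 1 then ((((i' : ℕ)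 + 1) / 2 : ℕ) : ℤ) else -((((i' : ℕ) / 2 : ℕ) : ℤ)))) / π)))
              + (if i = i' then (1 + θ⁻¹) * (((2 * B - 1 : ℕ) : ℝ) / (d₀ * ((2 * J + 1 : ℕ) * (((B₃ - 1 : ℕ) : ℝ)) ^ (2 * J + 1)))) * (4 * (π / 4 + (∑ k ∈ weilPrimeIndex a, (Λ k : ℝ) / Real.sqrt k) + a * (1 + weilArchDensity (2 * a)) / π) * (((if (i : ℕ) % 2 = 1 then ((((i : ℕ) + 1) / 2 : ℕ) : ℤ) else -((((i : ℕ) / 2 : ℕ) : ℤ)))).natAbs : ℝ) ^ J / π) ^ 2 else 0))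
            + ((1 + θ) * (1 + η) * ((π / 4 + (∑ k ∈ weilPrimeIndex a, (Λ k : ℝ) / Real.sqrt k) + a * (1 + weilArchDensity (2 * a)) / (π * B₃)) ^ 2 / (π ^ 2 * d₀)) * (∑ j : Fin J, ∑ j' : Fin J, (((1 / ((((j : ℕ) + 1) + ((j' : ℕ) + 1) - 1 : ℕ) * (((B₃ - 1 : ℕ) : ℝ)) ^ (((j : ℕ) + 1) + ((j' : ℕ) + 1) - 1)) + 1 / ((((j : ℕ) + 1) + ((j' : ℕ) + 1) - 1 : ℕ) * (B₃ : ℝ) ^ (((j : ℕ) + 1) + ((j' : ℕ) + 1) - 1))) / 2) + (if j = j' then (∑ j' : Fin J, ((1 / ((((j : ℕ) + 1) + ((j' : ℕ) + 1) - 1 : ℕ) * (((B₃ - 1 : ℕ) : ℝ)) ^ (((j : ℕ) + 1) + ((j' : ℕ) + 1) - 1)) - 1 / ((((j : ℕ) + 1) + ((j' : ℕ) + 1) - 1 : ℕ) * (B₃ : ℝ) ^ (((j : ℕ) + 1) + ((j' : ℕ) + 1) - 1))) / 2) * lam j' / lam j) else 0)) * ((-1 : ℝ) ^ ((j : ℕ)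 + 1) * ((-1 : ℝ) ^ (if (i : ℕ) % 2 = 1 then ((((i : ℕ) + 1) / 2 : ℕ) : ℤ) else -((((i : ℕ) / 2 : ℕ) : ℤ))) * (((if (i : ℕ) % 2 = 1 then ((((i : ℕ) + 1) / 2 : ℕ) : ℤ) else -((((i : ℕ) / 2 : ℕ) : ℤ))) : ℤ) : ℝ) ^ (j : ℕ))) * ((-1 : ℝ) ^ ((j' : ℕ) + 1) * ((-1 : ℝ) ^ (if (i' : ℕ) % 2 = 1 then ((((i' : ℕ) + 1) / 2 : ℕ) : ℤ) else -((((i' : ℕ) / 2 : ℕ) : ℤ))) * (((if (i' : ℕ) % 2 = 1 then ((((i' : ℕ) + 1) / 2 : ℕ) : ℤ) else -((((i' : ℕ) / 2 : ℕ) : ℤ))) : ℤ) : ℝ) ^ (j' : ℕ))))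
              + (1 + θ) * (1 + η⁻¹) * (1 / d₀) * (∑ j : Fin J, ∑ j' : Fin J, (((1 / ((((j : ℕ) + 1) + ((j' : ℕ) + 1) - 1 : ℕ) * (((B₃ - 1 : ℕ) : ℝ)) ^ (((j : ℕ) + 1) + ((j' : ℕ) + 1) - 1)) + 1 / ((((j : ℕ) + 1) + ((j' : ℕ) + 1) - 1 : ℕ) * (B₃ : ℝ) ^ (((j : ℕ) + 1) + ((j' : ℕ) + 1) - 1))) / 2) + (if j = j' then (∑ j' : Fin J, ((1 / ((((j : ℕ) + 1) + ((j' : ℕ) + 1) - 1 : ℕ) * (((B₃ - 1 : ℕ) : ℝ)) ^ (((j : ℕ) + 1) + ((j' : ℕ) + 1) - 1)) - 1 / ((((j : ℕ) + 1) + ((j' : ℕ) + 1) - 1 : ℕ) * (B₃ : ℝ) ^ (((j : ℕ) + 1) + ((j' : ℕ) + 1) - 1))) / 2) * lam j' / lam j) else 0)) * ((-1 : ℝ) ^ ((j : ℕ) + 1) * ((-1 : ℝ) ^ (if (i : ℕ) % 2 = 1 then ((((i : ℕ) + 1) / 2 : ℕ) : ℤ) else -((((i : ℕ) / 2 : ℕ)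 : ℤ))) * (-((((if (i : ℕ) % 2 = 1 then ((((i : ℕ) + 1) / 2 : ℕ) : ℤ) else -((((i : ℕ) / 2 : ℕ) : ℤ))) : ℤ) : ℝ) ^ (j : ℕ)) * ((Complex.digamma (1 / 4 + ((freq a (if (i : ℕ) % 2 = 1 then ((((i : ℕ) + 1) / 2 : ℕ) : ℤ) else -((((i : ℕ) / 2 : ℕ) : ℤ))) : ℝ) : ℂ) / 2 * I)).im / 2 + (∑ k ∈ weilPrimeIndex a, (Λ k : ℝ) / Real.sqrt k * ((χ (k : ZMod q)).re * Real.sin (freq a (if (i : ℕ) % 2 = 1 then ((((i : ℕ) + 1) / 2 : ℕ) : ℤ) else -((((i : ℕ) / 2 : ℕ) : ℤ))) * Real.log k) + (χ (k : ZMod q)).im * Real.cos (freq a (if (i : ℕ) % 2 = 1 then ((((i : ℕ) + 1) / 2 : ℕ) : ℤ) else -((((i : ℕ) / 2 : ℕ) : ℤ))) * Real.log k))) - archExpSumSin a (if (i : ℕ) % 2 = 1 then ((((i : ℕ) + 1) / 2 : ℕ) : ℤ) else -((((i : ℕ) / 2 : ℕ) : ℤ)))) / π))) * ((-1 : ℝ)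 ^ ((j' : ℕ) + 1) * ((-1 : ℝ) ^ (if (i' : ℕ) % 2 = 1 then ((((i' : ℕ) + 1) / 2 : ℕ) : ℤ) else -((((i' : ℕ) / 2 : ℕ) : ℤ))) * (-((((if (i' : ℕ) % 2 = 1 then ((((i' : ℕ) + 1) / 2 : ℕ) : ℤ) else -((((i' : ℕ) / 2 : ℕ) : ℤ))) : ℤ) : ℝ) ^ (j' : ℕ)) * ((Complex.digamma (1 / 4 + ((freq a (if (i' : ℕ) % 2 = 1 then ((((i' : ℕ) + 1) / 2 : ℕ) : ℤ) else -((((i' : ℕ) / 2 : ℕ) : ℤ))) : ℝ) : ℂ) / 2 * I)).im / 2 + (∑ k ∈ weilPrimeIndex a, (Λ k : ℝ) / Real.sqrt k * ((χ (k : ZMod q)).re * Real.sin (freq a (if (i' : ℕ) % 2 = 1 then ((((i' : ℕ) + 1) / 2 : ℕ) : ℤ) else -((((i' : ℕ) / 2 : ℕ) : ℤ))) * Real.log k) + (χ (k : ZMod q)).im * Real.cos (freq a (if (i' : ℕ) % 2 = 1 then ((((i' : ℕ) + 1) / 2 : ℕ) : ℤ) else -((((i' : ℕ) / 2 : ℕ)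 : ℤ))) * Real.log k))) - archExpSumSin a (if (i' : ℕ) % 2 = 1 then ((((i' : ℕ) + 1) / 2 : ℕ) : ℤ) else -((((i' : ℕ) / 2 : ℕ) : ℤ)))) / π))))
              + (if i = i' then (1 + θ⁻¹) * (((2 * B - 1 : ℕ) : ℝ) / (d₀ * ((2 * J + 1 : ℕ) * (((B₃ - 1 : ℕ) : ℝ)) ^ (2 * J + 1)))) * (4 * (π / 4 + (∑ k ∈ weilPrimeIndex a, (Λ k : ℝ) / Real.sqrt k) + a * (1 + weilArchDensity (2 * a)) / π) * (((if (i : ℕ) % 2 = 1 then ((((i : ℕ) + 1) / 2 : ℕ) : ℤ) else -((((i : ℕ) / 2 : ℕ) : ℤ)))).natAbs : ℝ) ^ J / π) ^ 2 else 0)) with hUGdef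
  set U2 : Matrix (Fin (2 * B - 1)) (Fin (2 * B - 1)) ℝ := Matrix.of fun i i' : Fin (2 * B - 1) ↦
    (1 + θ') * UG i i' + (if i = i' then (1 + θ'⁻¹) * ((∑ k : Fin (2 * B - 1), (1 / (B₃ : ℝ) + (if (k : ℕ) = 0 then 0 else 1 / ((((k : ℕ) + 1) / 2 : ℕ) : ℝ))) ^ 2) * (2 * (a * (1 - 1 / Real.cosh a) / π ^ 2) ^ 2 / (((B₃ - B : ℕ) : ℝ) * d₀))) else 0) with hU2def
  have hU2 : ∀ (N' : ℕ) (x : Fin (2 * B - 1) → ℝ),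
      ∑ j ∈ Finset.Ico (2 * B₃ - 1) N', (∑ i : Fin (2 * B - 1), M i j * x i) ^ 2 / W ((j + 1) / 2)
        ≤ x ⬝ᵥ U2 *ᵥ x := by
    intro N' x
    have hG := complex_tailJ_majorant_matrix χ ha hB1 hBB J lam hlam W hd0.1 hdmono hθ hη N' x
    rw [← hUGdef] at hG
    have hSt := sechBonus_tail_rw_enum ha hB1 hBB W hd0.1 hdmono N' x
    have hcol : ∀ j : ℕ, ∑ i : Fin (2 * B - 1), M i j * x i
        = (∑ i : Fin (2 * B - 1), (twistedGramCoeffC χ a (if (i : ℕ) % 2 = 1 then ((((i : ℕ) + 1) / 2 : ℕ) : ℤ) else -((((i : ℕ) / 2 : ℕ) : ℤ))) (if j % 2 = 1 then (((j + 1) / 2 : ℕ) : ℤ) else -((j / 2 : ℕ) : ℤ))).re * x i)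
          + ∑ i : Fin (2 * B - 1), ((ite ((if (i : ℕ) % 2 = 1 then ((((i : ℕ) + 1) / 2 : ℕ) : ℤ) else -((((i : ℕ) / 2 : ℕ) : ℤ))) = (if j % 2 = 1 then (((j + 1) / 2 : ℕ) : ℤ) else -((j / 2 : ℕ) : ℤ))) π 0) - sechIncrCoeff a (if (i : ℕ) % 2 = 1 then ((((i : ℕ) + 1) / 2 : ℕ) : ℤ) else -((((i : ℕ) / 2 : ℕ) : ℤ))) (if j % 2 = 1 then (((j + 1) / 2 : ℕ) : ℤ) else -((j / 2 : ℕ) : ℤ))) * x i := by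
      intro j
      rw [← Finset.sum_add_distrib]
      refine Finset.sum_congr rfl fun i _ ↦ ?_
      rw [hMsplit, add_mul]
    have hpp : ∀ j ∈ Finset.Ico (2 * B₃ - 1) N', (∑ i : Fin (2 * B - 1), M i j * x i) ^ 2 / W ((j + 1) / 2)
        ≤ (1 + θ') * ((∑ i : Fin (2 * B - 1), (twistedGramCoeffC χ a (if (i : ℕ) % 2 = 1 then ((((i : ℕ) + 1) / 2 : ℕ) : ℤ) else -((((i : ℕ) / 2 : ℕ) : ℤ))) (if j % 2 = 1 then (((j + 1) / 2 : ℕ) : ℤ) else -((j / 2 : ℕ) : ℤ))).re * x i) ^ 2 / W ((j + 1) / 2))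
          + (1 + θ'⁻¹) * ((∑ i : Fin (2 * B - 1), ((ite ((if (i : ℕ) % 2 = 1 then ((((i : ℕ) + 1) / 2 : ℕ) : ℤ) else -((((i : ℕ) / 2 : ℕ) : ℤ))) = (if j % 2 = 1 then (((j + 1) / 2 : ℕ) : ℤ) else -((j / 2 : ℕ) : ℤ))) π 0) - sechIncrCoeff a (if (i : ℕ) % 2 = 1 then ((((i : ℕ) + 1) / 2 : ℕ) : ℤ) else -((((i : ℕ) / 2 : ℕ) : ℤ))) (if j % 2 = 1 then (((j + 1) / 2 : ℕ) : ℤ) else -((j / 2 : ℕ) : ℤ))) * x i) ^ 2 / W ((j + 1) / 2)) := by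
      intro j hj
      have hWj : 0 < W ((j + 1) / 2) := hd j (by have := (Finset.mem_Ico.mp hj).1; omega)
      rw [hcol j]
      have h := sq_add_le_peterPaul (η := θ') hθ' (p :=
        (∑ i : Fin (2 * B - 1), (twistedGramCoeffC χ a (if (i : ℕ) % 2 = 1 then ((((i : ℕ) + 1) / 2 : ℕ) : ℤ) else -((((i : ℕ) / 2 : ℕ) : ℤ))) (if j % 2 = 1 then (((j + 1) / 2 : ℕ) : ℤ) else -((j / 2 : ℕ) : ℤ))).re * x i))
        (q := (∑ i : Fin (2 * B - 1), ((ite ((if (i : ℕ) % 2 = 1 then ((((i : ℕ) + 1) / 2 : ℕ) : ℤ) else -((((i : ℕ) / 2 : ℕ) : ℤ))) = (if j % 2 = 1 then (((j + 1) / 2 : ℕ) : ℤ) else -((j / 2 : ℕ) : ℤ))) π 0) - sechIncrCoeff a (if (i : ℕ) % 2 = 1 then ((((i : ℕ) + 1) / 2 : ℕ) : ℤ) else -((((i : ℕ) / 2 : ℕ) : ℤ))) (if j % 2 = 1 then (((j + 1) / 2 : ℕ) : ℤ) else -((j / 2 : ℕ) : ℤ))) * x i))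
      calc _ ≤ ((1 + θ') * (∑ i : Fin (2 * B - 1), (twistedGramCoeffC χ a (if (i : ℕ) % 2 = 1 then ((((i : ℕ) + 1) / 2 : ℕ) : ℤ) else -((((i : ℕ) / 2 : ℕ) : ℤ))) (if j % 2 = 1 then (((j + 1) / 2 : ℕ) : ℤ) else -((j / 2 : ℕ) : ℤ))).re * x i) ^ 2
            + (1 + θ'⁻¹) * (∑ i : Fin (2 * B - 1), ((ite ((if (i : ℕ) % 2 = 1 then ((((i : ℕ) + 1) / 2 : ℕ) : ℤ) else -((((i : ℕ) / 2 : ℕ) : ℤ))) = (if j % 2 = 1 then (((j + 1) / 2 : ℕ) : ℤ) else -((j / 2 : ℕ) : ℤ))) π 0) - sechIncrCoeff a (if (i : ℕ) % 2 = 1 then ((((i : ℕ) + 1) / 2 : ℕ) : ℤ) else -((((i : ℕ) / 2 : ℕ) : ℤ))) (if j % 2 = 1 then (((j + 1) / 2 : ℕ) : ℤ) else -((j / 2 : ℕ) : ℤ))) * x i) ^ 2) / W ((j + 1) / 2) :=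
            div_le_div_of_nonneg_right h hWj.le
        _ = _ := by ring
    calc _ ≤ ∑ j ∈ Finset.Ico (2 * B₃ - 1) N',
          ((1 + θ') * ((∑ i : Fin (2 * B - 1), (twistedGramCoeffC χ a (if (i : ℕ) % 2 = 1 then ((((i : ℕ) + 1) / 2 : ℕ) : ℤ) else -((((i : ℕ) / 2 : ℕ) : ℤ))) (if j % 2 = 1 then (((j + 1) / 2 : ℕ) : ℤ) else -((j / 2 : ℕ) : ℤ))).re * x i) ^ 2 / W ((j + 1) / 2))
            + (1 + θ'⁻¹) * ((∑ i : Fin (2 * B - 1), ((ite ((if (i : ℕ) % 2 = 1 then ((((i : ℕ) + 1) / 2 : ℕ) : ℤ) else -((((i : ℕ) / 2 : ℕ) : ℤ))) = (if j % 2 = 1 then (((j + 1) / 2 : ℕ) : ℤ) else -((j / 2 : ℕ) : ℤ))) π 0) - sechIncrCoeff a (if (i : ℕ) % 2 = 1 then ((((i : ℕ) + 1) / 2 : ℕ) : ℤ) else -((((i : ℕ) / 2 : ℕ) : ℤ))) (if j % 2 = 1 then (((j + 1) / 2 : ℕ) : ℤ) else -((j / 2 : ℕ) : ℤ))) * x i)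 ^ 2 / W ((j + 1) / 2))) :=
          Finset.sum_le_sum hpp
      _ = (1 + θ') * ∑ j ∈ Finset.Ico (2 * B₃ - 1) N',
              (∑ i : Fin (2 * B - 1), (twistedGramCoeffC χ a (if (i : ℕ) % 2 = 1 then ((((i : ℕ) + 1) / 2 : ℕ) : ℤ) else -((((i : ℕ) / 2 : ℕ) : ℤ))) (if j % 2 = 1 then (((j + 1) / 2 : ℕ) : ℤ) else -((j / 2 : ℕ) : ℤ))).re * x i) ^ 2 / W ((j + 1) / 2)
          + (1 + θ'⁻¹) * ∑ j ∈ Finset.Ico (2 * B₃ - 1) N',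
              (∑ i : Fin (2 * B - 1), ((ite ((if (i : ℕ) % 2 = 1 then ((((i : ℕ) + 1) / 2 : ℕ) : ℤ) else -((((i : ℕ) / 2 : ℕ) : ℤ))) = (if j % 2 = 1 then (((j + 1) / 2 : ℕ) : ℤ) else -((j / 2 : ℕ) : ℤ))) π 0) - sechIncrCoeff a (if (i : ℕ) % 2 = 1 then ((((i : ℕ) + 1) / 2 : ℕ) : ℤ) else -((((i : ℕ) / 2 : ℕ) : ℤ))) (if j % 2 = 1 then (((j + 1) / 2 : ℕ) : ℤ) else -((j / 2 : ℕ) : ℤ))) * x i) ^ 2 / W ((j + 1) / 2) := by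
          rw [Finset.sum_add_distrib, Finset.mul_sum, Finset.mul_sum]
      _ ≤ (1 + θ') * (x ⬝ᵥ UG *ᵥ x) + (1 + θ'⁻¹) * (((∑ k : Fin (2 * B - 1), (1 / (B₃ : ℝ) + (if (k : ℕ) = 0 then 0 else 1 / ((((k : ℕ) + 1) / 2 : ℕ) : ℝ))) ^ 2) * (2 * (a * (1 - 1 / Real.cosh a) / π ^ 2) ^ 2 / (((B₃ - B : ℕ) : ℝ) * d₀))) * ∑ i : Fin (2 * B - 1), x i ^ 2) :=
          add_le_add (mul_le_mul_of_nonneg_left hG (by positivity)) (mul_le_mul_of_nonneg_left hSt (by positivity))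
      _ = (1 + θ') * (x ⬝ᵥ UG *ᵥ x) + ((1 + θ'⁻¹) * ((∑ k : Fin (2 * B - 1), (1 / (B₃ : ℝ) + (if (k : ℕ) = 0 then 0 else 1 / ((((k : ℕ) + 1) / 2 : ℕ) : ℝ))) ^ 2) * (2 * (a * (1 - 1 / Real.cosh a) / π ^ 2) ^ 2 / (((B₃ - B : ℕ) : ℝ) * d₀)))) * ∑ i : Fin (2 * B - 1), x i ^ 2 := by ring
      _ = x ⬝ᵥ U2 *ᵥ x := by
          -- `t·xᵀUx + s·‖x‖² = xᵀ(tU + sI)x` (as `dotProduct_scale_add_diag` of the isotropic door, inlined)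
          rw [hU2def, dotProduct_mulVec_eq_sum_sum, dotProduct_mulVec_eq_sum_sum, Finset.mul_sum, Finset.mul_sum,
            ← Finset.sum_add_distrib]
          refine Finset.sum_congr rfl fun i _ ↦ ?_
          simp only [Matrix.of_apply, mul_add, Finset.sum_add_distrib, Finset.mul_sum, mul_ite, mul_zero,
            Finset.sum_ite_eq, Finset.mem_univ, if_true]
          congr 1
          · exact Finset.sum_congr rfl fun i' _ ↦ by ring
          · ring
  refine weilPositivityOnChar_of_twistedGramCoeffOddC_re_psd hq χ hodd ha fun N x ↦ ?_
  set v : ℕ → ℝ := fun j ↦ x (if j % 2 = 1 then (((j + 1) / 2 : ℕ) : ℤ) else -((j / 2 : ℕ) : ℤ)) with hv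
  have key := sum_range_mul_mul_nonneg_of_certificate_sum_split M hsymm (2 * B - 1) (2 * B₃ - 1) (by omega)
    (fun j ↦ W ((j + 1) / 2)) _ U2 hd hfar hU1 (fun N' x ↦ hU2 N' x) (fun x ↦ by
      have h := hS x
      simp only [hU2def, hUGdef, Matrix.of_apply] at h ⊢
      exact h) (2 * N + 1) v
  rw [sum_sum_range_enum (fun j j' ↦ v j * v j' * M j j') N] at key
  have hx : ∀ p : ℤ, v (if 0 < p then 2 * p.natAbs - 1 else 2 * p.natAbs) = x p := fun p ↦ by
    simp only [hv]
    split_ifs <;> first | omega | (congr 1; omega)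
  simp_rw [hx, hM] at key
  exact key

end Rung

end Summit.Ventures.WeilGRH

end
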